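import Literature.RepresentationTheory.HeisenbergGroup.LeraySectionParabolicValue
import Literature.RepresentationTheory.HeisenbergGroup.SchrodingerConjugateTorusSpherical
import HarnessLib

/-!
# Leray-normalised sections agree on common stabilisers; the Levi value in a Gram model

Topic `RepresentationTheory/HeisenbergGroup`; namespace `Literature.RepresentationTheory.HeisenbergGroup`. KERNEL
mathematics only (theorems; no definition, no named fact, no `axiom`, no `sorry`). Sequel of
`ImplementerSectionRigidity.lean` (rigidity, `Sp`-equivariance of Leray sections) and
`LeraySectionParabolicValue.lean` (value at the origin on a Siegel parabolic).

Let `F` be a non-archimedean local field of characteristic `0`, `ψ` a continuous non-trivial character, `(V, A)`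
(`A = alt β`) a symplectic space, `ρ` a model of the Heisenberg representation with implementers unique up to
scalars, and `r` a normalised section of implementers whose multiplier is the Leray cocycle `c_ℓ` of a Lagrangian
`ℓ` ([Rangarao1993] Thm 4.1; [MoeglinVignerasWaldspurger1987] Chap. 3 I.3).

* §1 `apply_conj_of_map_eq` — **on the stabiliser, conjugation is honest**: if `y` and `δ y δ⁻¹` both fix `ℓ`
  then `r(δ y δ⁻¹) = r(δ) r(y) r(δ)⁻¹` (the Leray cocycle is `1` as soon as one of the two arguments fixes `ℓ`,
  [Rangarao1993] Thm 4.1 (1)–(2): `c_ℓ(δ, y) = 1 = c_ℓ(δ y δ⁻¹, δ)`).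
* §2 `leraySection_apply_eq_of_map_eq` — **TWO LERAY SECTIONS AGREE ON A COMMON STABILISER**: if `r₁`, `r₂` are
  Leray-normalised for the Lagrangians `ℓ₁`, `ℓ₂` (same `ψ`, same Haar measure) and `h ∈ Sp` fixes BOTH `ℓ₁` and
  `ℓ₂`, then `r₁(h) = r₂(h)` — by transitivity of `Sp` on Lagrangians (`exists_isometries_map_eq`), the
  `Sp`-equivariance `r₂(δ g δ⁻¹) = r₁(δ) r₁(g) r₁(δ)⁻¹` (`leraySection_apply_conj`, [Rangarao1993] Lemma 5.1;
  [LionVergne1980] §1.6.18) and §1. In words: the canonical lift of `h` to the metaplectic group attached to a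
  Lagrangian fixed by `h` does not depend on that Lagrangian ([LionVergne1980] §1.7; [MoeglinVignerasWaldspurger1987]
  Chap. 2 II.6).
* §3 `leraySection_apply_transportSp_levi` — **THE LEVI VALUE IN A GRAM MODEL**: for the Schrödinger model
  `ρ_T = schrodingerSB β_T ψ` of a Gram duality `β_T(x, y) = ⟨x, T y⟩` (`det T` a unit) and `r` Leray-normalised at
  `ψ(½·)` for `ℓ_Y = 0 ⊕ F^ι`, the value on the transported Siegel Levi is the tree's normalised Levi operator:
  `r(m(a)) = leviOpPi (x ↦ a x)`, i.e. `(r(m(a))Φ)(x) = |det a|^{-1/2} Φ(a⁻¹x)` ([Rangarao1993] Lemma 3.2 (3.7);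
  [MoeglinVignerasWaldspurger1987] Chap. 2 II.6): both implement `m(a)`, and the scalar is read off at the origin
  (`apply_zero_conj_eq_gram`, `det(m(a)|_{ℓ_Y}) = det a⁻¹`).

Written for the explicit split-place model of the local Weil representation of the doubled unitary group
([Kudla1994] Thm 3.1; [HarrisKudlaSweet1996] §1 (1.15)–(1.16)) — cell `hodgecm-mathlib`, d6 card S4b-3; nothing
here is specific to unitary groups.

## References

* R. Ranga Rao, *On some explicit formulas in the theory of Weil representation*, Pacific J. Math. 157 (1993)
  335–371: Lemma 3.2 (3.7) p. 351, Thm 3.5 p. 355, Thm 4.1 (1)–(2) p. 358, Lemma 5.1 p. 361 [Rangarao1993].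
* G. Lion, M. Vergne, *The Weil representation, Maslov index and theta series*, Progress in Math. 6 (1980),
  §1.6.18, §1.7 [LionVergne1980].
* C. Mœglin, M.-F. Vignéras, J.-L. Waldspurger, *Correspondances de Howe sur un corps p-adique*, LNM 1291 (1987),
  Chap. 2 II.2, II.6; Chap. 3 I.3 [MoeglinVignerasWaldspurger1987].
-/

set_option autoImplicit false

noncomputable section

namespace Literature.RepresentationTheory.HeisenbergGroup

open _root_.MeasureTheory Matrix
open Literature.GroupTheory Literature.NumberTheory.Automorphic
open Literature.NumberTheory.GaloisRepresentations.IsNonarchimedeanLocalField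
open Literature.NumberTheory.Weil1964 Literature.LinearAlgebra.QuadraticForm
open SymplecticMatrix

/-! ## §0 Images of submodules under products and inverses in `Sp` -/

section Maps

variable {F : Type*} [Field F] {V : Type*} [AddCommGroup V] [Module F V] {β : V →ₗ[F] V →ₗ[F] F}

/-- `(g h) ℓ = g (h ℓ)` for elements of `Sp(V, A)` (the action of `Sp` on subspaces / Lagrangians).
[cite: Rangarao1993, §2.2 p. 338] -/
theorem map_coe_mul (ℓ : Submodule F V) (g h : symplecticGroup β) :
    ℓ.map (((g * h : symplecticGroup β) : V ≃ₗ[F] V) : V →ₗ[F] V) =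
      (ℓ.map ((h : V ≃ₗ[F] V) : V →ₗ[F] V)).map ((g : V ≃ₗ[F] V) : V →ₗ[F] V) := by
  rw [← Submodule.map_comp]
  rfl

/-- `gℓ = ℓ' ⇒ g⁻¹ℓ' = ℓ` in `Sp(V, A)` (the action of `Sp` on subspaces / Lagrangians).
[cite: Rangarao1993, §2.2 p. 338] -/
theorem map_coe_inv_of_map_eq {ℓ ℓ' : Submodule F V} {g : symplecticGroup β}
    (hg : ℓ.map ((g : V ≃ₗ[F] V) : V →ₗ[F] V) = ℓ') :
    ℓ'.map (((g⁻¹ : symplecticGroup β) : V ≃ₗ[F] V) : V →ₗ[F] V) = ℓ := by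
  rw [← hg, ← map_coe_mul, inv_mul_cancel, OneMemClass.coe_one, LinearEquiv.coe_toLinearMap_one, Submodule.map_id]

end Maps

/-! ## §1 On the stabiliser of the Lagrangian, conjugation is honest -/

section Leray

variable {F : Type*} [Field F] [ValuativeRel F] [TopologicalSpace F] [IsNonarchimedeanLocalField F]
  [MeasurableSpace F] [BorelSpace F] (μ : Measure F) [μ.IsAddHaarMeasure] {ψ : AddChar F Circle}
  [Invertible (2 : F)]
variable {V : Type*} [AddCommGroup V] [Module F V] [FiniteDimensional F V] {β : V →ₗ[F] V →ₗ[F] F}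
variable {S : Type*} [AddCommGroup S] [Module ℂ S] [Nontrivial S] {ρ : Representation ℂ (Heisenberg β) S}

/-- **`r(δ y δ⁻¹) = r(δ) r(y) r(δ)⁻¹` whenever `y` and `δ y δ⁻¹` both fix the Lagrangian `ℓ`** of the Leray
cocycle of `r`: `c_ℓ(δ, y) = 1` (`y ∈ P_ℓ` on the right) and `c_ℓ(δyδ⁻¹, δ) = 1` (`δyδ⁻¹ ∈ P_ℓ` on the left) give
`r(δ) r(y) = r(δy) = r(δyδ⁻¹) r(δ)`. [cite: Rangarao1993, Thm 4.1 (1)–(2), p. 358] -/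
theorem ImplementerSection.apply_conj_of_map_eq (hψ : ψ.IsContinuousNontrivial) (hA : (alt β).IsAlt)
    (hN : (alt β).Nondegenerate) {ℓ : Submodule F V} (hℓ : LinearMap.BilinForm.orthogonal (alt β) ℓ = ℓ)
    (hU : ImplementerUniqueUpToScalar ρ) (r : ImplementerSection ρ)
    (hr : r.cocycle hU = lerayCentralCocycle μ hψ hA hN hℓ) (δ y : symplecticGroup β)
    (hy : ℓ.map ((y : V ≃ₗ[F] V) : V →ₗ[F] V) = ℓ)
    (hδy : ℓ.map (((δ * y * δ⁻¹ : symplecticGroup β) : V ≃ₗ[F] V) : V →ₗ[F] V) = ℓ) :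
    r (δ * y * δ⁻¹) = r δ * r y * (r δ)⁻¹ := by
  have hiso : ∀ x ∈ ℓ, ∀ x' ∈ ℓ, (alt β) x x' = 0 := isotropic_of_orthogonal_eq_self hℓ
  -- `c_ℓ(δ, y) = 1`
  have h1 : r.cocycle hU δ y = 1 := by
    apply Units.ext
    rw [hr]
    change lerayCocycle ψ μ (alt β) ℓ (δ : V ≃ₗ[F] V) (y : V ≃ₗ[F] V) = (1 : ℂ)
    exact lerayCocycle_eq_one_of_map_eq_right μ hψ (alt β) hiso δ.2 hy
  -- `c_ℓ(δ y δ⁻¹, δ) = 1`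
  have h2 : r.cocycle hU (δ * y * δ⁻¹) δ = 1 := by
    apply Units.ext
    rw [hr]
    change lerayCocycle ψ μ (alt β) ℓ ((δ * y * δ⁻¹ : symplecticGroup β) : V ≃ₗ[F] V) (δ : V ≃ₗ[F] V) = (1 : ℂ)
    exact lerayCocycle_eq_one_of_map_eq_left μ hψ (alt β) hiso hδy _
  rw [ImplementerSection.cocycle_eq_one_iff] at h1 h2
  rw [show δ * y * δ⁻¹ * δ = δ * y by group, h1] at h2
  -- `h2 : r δ * r y = r (δ y δ⁻¹) * r δ`
  rw [eq_mul_inv_iff_mul_eq]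
  exact h2.symm

/-! ## §2 Two Leray sections agree on a common stabiliser -/

/-- **TWO LERAY-NORMALISED SECTIONS AGREE ON A COMMON STABILISER.** Let `r₁`, `r₂` be normalised sections of
implementers of `ρ` whose cocycles are the Leray cocycles of the Lagrangians `ℓ₁`, `ℓ₂` (same character `ψ`, same
Haar measure `μ`), and let `h ∈ Sp(V, A)` fix both `ℓ₁` and `ℓ₂`. Then `r₁(h) = r₂(h)` — provided `Sp(V, A)` has no
characters (e.g. a Gram duality in characteristic `0`, `monoidHom_symplecticGroup_gram_eq_one`). Proof: choose
`δ ∈ Sp` with `δ ℓ₁ = ℓ₂` (`exists_isometries_map_eq`); then `r₂(δ g δ⁻¹) = r₁(δ) r₁(g) r₁(δ)⁻¹` for all `g`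
(`leraySection_apply_conj`), and at `g = δ⁻¹ h δ ∈ P_{ℓ₁}` (with `δ g δ⁻¹ = h ∈ P_{ℓ₁}`) the right-hand side is
`r₁(h)` by §1. [cite: Rangarao1993, Lemma 5.1, Thm 4.1 (1)–(2); LionVergne1980, §1.6.18, §1.7] -/
theorem leraySection_apply_eq_of_map_eq (htriv : ∀ χ : symplecticGroup β →* ℂˣ, χ = 1)
    (hψ : ψ.IsContinuousNontrivial) (hA : (alt β).IsAlt) (hN : (alt β).Nondegenerate)
    {ℓ₁ ℓ₂ : Submodule F V} (hℓ₁ : LinearMap.BilinForm.orthogonal (alt β) ℓ₁ = ℓ₁)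
    (hℓ₂ : LinearMap.BilinForm.orthogonal (alt β) ℓ₂ = ℓ₂)
    (hU : ImplementerUniqueUpToScalar ρ) (r₁ r₂ : ImplementerSection ρ)
    (hr₁ : r₁.cocycle hU = lerayCentralCocycle μ hψ hA hN hℓ₁)
    (hr₂ : r₂.cocycle hU = lerayCentralCocycle μ hψ hA hN hℓ₂)
    (h : symplecticGroup β) (h₁ : ℓ₁.map ((h : V ≃ₗ[F] V) : V →ₗ[F] V) = ℓ₁)
    (h₂ : ℓ₂.map ((h : V ≃ₗ[F] V) : V →ₗ[F] V) = ℓ₂) : r₁ h = r₂ h := by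
  obtain ⟨δ, hδ⟩ : ∃ δ : symplecticGroup β, ℓ₁.map ((δ : V ≃ₗ[F] V) : V →ₗ[F] V) = ℓ₂ :=
    exists_isometries_map_eq hA hN hℓ₁ hℓ₂
  subst hδ
  -- `Sp`-equivariance at `g = δ⁻¹ h δ`
  have key := leraySection_apply_conj μ htriv hψ hA hN hℓ₁ δ hU r₁ r₂ hr₁ hr₂ (δ⁻¹ * h * δ)
  have e1 : δ * (δ⁻¹ * h * δ) * δ⁻¹ = h := by group
  rw [e1] at key
  -- `δ⁻¹ h δ` fixes `ℓ₁`
  have hy : ℓ₁.map (((δ⁻¹ * h * δ : symplecticGroup β) : V ≃ₗ[F] V) : V →ₗ[F] V) = ℓ₁ := by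
    rw [map_coe_mul, map_coe_mul, h₂]
    exact map_coe_inv_of_map_eq rfl
  have key₁ := ImplementerSection.apply_conj_of_map_eq μ hψ hA hN hℓ₁ hU r₁ hr₁ δ (δ⁻¹ * h * δ) hy
    (by rw [e1]; exact h₁)
  rw [e1] at key₁
  rw [key, key₁]

end Leray

/-! ## §3 The Levi value of a Leray section in a Gram model -/

section Gram

variable {F : Type*} [Field F] [ValuativeRel F] [TopologicalSpace F] [IsNonarchimedeanLocalField F] [CharZero F]
  {ι : Type*} [Fintype ι] [DecidableEq ι] [Invertible (2 : F)] (T : Matrix ι ι F) (hT : IsUnit T.det)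
  {ψ : AddChar F Circle} (hl : IsLocallyConstant (⇑ψ : F → Circle))
  (hbT : ∀ y : ι → F, Continuous fun u : ι → F => Matrix.toLinearMap₂' F T u y)
  [MeasurableSpace F] [BorelSpace F] (μ : Measure F) [μ.IsAddHaarMeasure]

omit [CharZero F] [MeasurableSpace F] [BorelSpace F] in
/-- `leviOpPi (x ↦ a x)` implements the transported Levi element `m(a) = transportSp T (levi a)` in the Gram model
`ρ_T` (the scalar `|det a|^{-1/2}` is immaterial). [cite: MoeglinVignerasWaldspurger1987, Chap. 2 II.6; Weil1964, n° 13, p. 160] -/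
theorem implements_transportSp_levi_leviOpPi (a : GL ι F) :
    Implements (schrodingerSB (Matrix.toLinearMap₂' F T) ψ hl hbT) (ofSymplectic _ (transportSp T hT (levi a)))
      (leviOpPi (glEquiv a)) := by
  have h1 := implements_transportSp_levi T hT hl hbT a (ψ := ψ)
  have h0 : Implements (schrodingerSB (Matrix.toLinearMap₂' F T) ψ hl hbT) 1
      (scalarOp (S := SchwartzBruhat (ι → F)) (modSqrtUnit (glEquiv a))⁻¹) := by
    have := (mem_MpPsi (schrodingerSB (Matrix.toLinearMap₂' F T) ψ hl hbT) _).1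
      (one_scalarOp_mem_MpPsi (schrodingerSB (Matrix.toLinearMap₂' F T) ψ hl hbT) (modSqrtUnit (glEquiv a))⁻¹)
    rwa [map_one] at this
  have := Implements.mul _ h0 h1
  rwa [one_mul] at this

omit [ValuativeRel F] [TopologicalSpace F] [IsNonarchimedeanLocalField F] [CharZero F] [Invertible (2 : F)]
  [MeasurableSpace F] [BorelSpace F] in
/-- `m(a)` fixes `ℓ_Y = 0 ⊕ F^ι`. [cite: Rangarao1993, §2.2, p. 338; Weil1964, n° 7, p. 152] -/
theorem map_transportSp_levi_prod_bot_top (a : GL ι F) :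
    Submodule.map (((transportSp T hT (levi a) : symplecticGroup (polar (Matrix.toLinearMap₂' F T))) :
        ((ι → F) × (ι → F)) ≃ₗ[F] ((ι → F) × (ι → F))) : ((ι → F) × (ι → F)) →ₗ[F] ((ι → F) × (ι → F)))
      (Submodule.prod (⊥ : Submodule F (ι → F)) (⊤ : Submodule F (ι → F))) =
      Submodule.prod (⊥ : Submodule F (ι → F)) (⊤ : Submodule F (ι → F)) :=
  map_prod_bot_top_eq_of _ fun v => by
    rw [transportSp_levi, coe_leviSp_apply]
    exact (glEquiv a).map_eq_zero_iff

omit [CharZero F] [Invertible (2 : F)] [MeasurableSpace F] [BorelSpace F] in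
/-- `|det a|^{1/2} = √|det a|` for the automorphism `x ↦ a x` of `F^ι`. [cite: Rangarao1993, Lemma 3.2 (1), p. 351] -/
theorem modSqrt_glEquiv (a : GL ι F) :
    modSqrt (glEquiv a) = Real.sqrt (normAbs F ((a : GL ι F) : Matrix ι ι F).det) := by
  have hlin : ((glEquiv a : (ι → F) ≃ₗ[F] (ι → F)) : (ι → F) →ₗ[F] (ι → F)) =
      Matrix.toLin' ((a : GL ι F) : Matrix ι ι F) := by
    apply LinearMap.ext; intro x; simp [Matrix.toLin'_apply]
  rw [modSqrt, hlin, LinearMap.det_toLin']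

omit [ValuativeRel F] [TopologicalSpace F] [IsNonarchimedeanLocalField F] [CharZero F] [Invertible (2 : F)]
  [MeasurableSpace F] [BorelSpace F] in
/-- `det (m(a)|_{ℓ_Y}) = det a⁻¹`: on `ℓ_Y` the Levi element acts through `y ↦ T⁻¹ a⁻ᵀ T y`.
[cite: Rangarao1993, Lemma 3.2 (1), p. 351] -/
theorem det_restrict_transportSp_levi (a : GL ι F)
    (hg : Submodule.map (((transportSp T hT (levi a) : symplecticGroup (polar (Matrix.toLinearMap₂' F T))) :
        ((ι → F) × (ι → F)) ≃ₗ[F] ((ι → F) × (ι → F))) : ((ι → F) × (ι → F)) →ₗ[F] ((ι → F) × (ι → F)))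
      (Submodule.prod (⊥ : Submodule F (ι → F)) (⊤ : Submodule F (ι → F))) =
      Submodule.prod (⊥ : Submodule F (ι → F)) (⊤ : Submodule F (ι → F))) :
    LinearMap.det
      ((((transportSp T hT (levi a) : symplecticGroup (polar (Matrix.toLinearMap₂' F T))) :
        ((ι → F) × (ι → F)) ≃ₗ[F] ((ι → F) × (ι → F))) : ((ι → F) × (ι → F)) →ₗ[F] ((ι → F) × (ι → F))).restrict
        (p := Submodule.prod (⊥ : Submodule F (ι → F)) (⊤ : Submodule F (ι → F)))
        (q := Submodule.prod (⊥ : Submodule F (ι → F)) (⊤ : Submodule F (ι → F)))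
        fun _ hx => hg.le (Submodule.mem_map_of_mem hx)) = (((a⁻¹ : GL ι F) : Matrix ι ι F)).det := by
  -- conjugate by `y ↦ (0, y)`
  let eY : (ι → F) ≃ₗ[F] (Submodule.prod (⊥ : Submodule F (ι → F)) (⊤ : Submodule F (ι → F))) :=
    { toFun := fun y => ⟨(0, y), (mem_prod_bot_top_iff _).2 rfl⟩
      invFun := fun p => (p : ((ι → F) × (ι → F))).2
      map_add' := fun y y' => Subtype.ext (Prod.ext (by simp) rfl)
      map_smul' := fun t y => Subtype.ext (Prod.ext (by simp) rfl)
      left_inv := fun y => rfl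
      right_inv := fun p => Subtype.ext (Prod.ext ((mem_prod_bot_top_iff _).1 p.2).symm rfl) }
  have hqY : ∀ y : ι → F, ((transportSp T hT (levi a) : symplecticGroup (polar (Matrix.toLinearMap₂' F T))) :
      ((ι → F) × (ι → F)) ≃ₗ[F] ((ι → F) × (ι → F))) (0, y) = (0, leviDual T hT a y) := fun y => by
    rw [transportSp_levi, coe_leviSp_apply, map_zero]
  have hdet : LinearMap.det
      ((((transportSp T hT (levi a) : symplecticGroup (polar (Matrix.toLinearMap₂' F T))) :
        ((ι → F) × (ι → F)) ≃ₗ[F] ((ι → F) × (ι → F))) : ((ι → F) × (ι → F)) →ₗ[F] ((ι → F) × (ι → F))).restrict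
        (p := Submodule.prod (⊥ : Submodule F (ι → F)) (⊤ : Submodule F (ι → F)))
        (q := Submodule.prod (⊥ : Submodule F (ι → F)) (⊤ : Submodule F (ι → F)))
        fun _ hx => hg.le (Submodule.mem_map_of_mem hx)) =
      LinearMap.det ((leviDual T hT a : (ι → F) ≃ₗ[F] (ι → F)) : (ι → F) →ₗ[F] (ι → F)) := by
    rw [← LinearMap.det_conj ((leviDual T hT a : (ι → F) ≃ₗ[F] (ι → F)) : (ι → F) →ₗ[F] (ι → F)) eY]
    congr 1
    apply LinearMap.ext
    intro p
    apply Subtype.ext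
    have hp : (p : ((ι → F) × (ι → F))) = (0, (p : ((ι → F) × (ι → F))).2) :=
      Prod.ext ((mem_prod_bot_top_iff _).1 p.2) rfl
    rw [LinearMap.coe_restrict_apply]
    change ((transportSp T hT (levi a) : symplecticGroup (polar (Matrix.toLinearMap₂' F T))) :
      ((ι → F) × (ι → F)) ≃ₗ[F] ((ι → F) × (ι → F))) (p : ((ι → F) × (ι → F))) =
      (0, leviDual T hT a (p : ((ι → F) × (ι → F))).2)
    conv_lhs => rw [hp]
    rw [hqY]
  have hlin : ((leviDual T hT a : (ι → F) ≃ₗ[F] (ι → F)) : (ι → F) →ₗ[F] (ι → F)) =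
      Matrix.toLin' (T⁻¹ * ((a⁻¹ : GL ι F) : Matrix ι ι F)ᵀ * T) := by
    apply LinearMap.ext; intro x; simp [Matrix.toLin'_apply, Matrix.mul_assoc]
  have hTT : T.det * T⁻¹.det = 1 := by
    rw [← Matrix.det_mul, Matrix.mul_nonsing_inv T hT, Matrix.det_one]
  rw [hdet, hlin, LinearMap.det_toLin', Matrix.det_mul, Matrix.det_mul, Matrix.det_transpose]
  linear_combination (((a⁻¹ : GL ι F) : Matrix ι ι F)).det * hTT

/-- **THE LEVI VALUE OF A LERAY SECTION IN A GRAM MODEL.** Let `ρ_T = schrodingerSB β_T ψ` be the Schrödinger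
model of the Gram duality `β_T(x, y) = ⟨x, T y⟩` (`det T` a unit), and `r` THE normalised section of implementers
whose multiplier is the Leray cocycle `c^{ψ(½·)}_{ℓ_Y}` of `ℓ_Y = 0 ⊕ F^ι`. Then on the transported Siegel Levi
`m(a) = transportSp T (levi a)` (`a ∈ GL_ι(F)`) the section is the tree's normalised Levi operator:
`r(m(a)) = leviOpPi (x ↦ a x)`, `(r(m(a)) Φ)(x) = |det a|^{-1/2} Φ(a⁻¹ x)` — both implement `m(a)`, so they differ
by a scalar, which is `1` by the value at the origin `(r(m(a))Φ)(0) = |det(m(a)|_{ℓ_Y})|^{1/2} Φ(0) = |det a|^{-1/2} Φ(0)`.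
[cite: Rangarao1993, Lemma 3.2 (1), (3.7)–(3.8), p. 351, Thm 3.5 (3), p. 355; MoeglinVignerasWaldspurger1987, Chap. 2 II.6] -/
theorem leraySection_apply_transportSp_levi (hψ : ψ.IsContinuousNontrivial)
    (hU : ImplementerUniqueUpToScalar (schrodingerSB (Matrix.toLinearMap₂' F T) ψ hl hbT))
    (r : ImplementerSection (schrodingerSB (Matrix.toLinearMap₂' F T) ψ hl hbT))
    (hY : LinearMap.BilinForm.orthogonal (alt (polar (Matrix.toLinearMap₂' F T)))
      (Submodule.prod (⊥ : Submodule F (ι → F)) (⊤ : Submodule F (ι → F))) =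
      Submodule.prod (⊥ : Submodule F (ι → F)) (⊤ : Submodule F (ι → F)))
    (hr : r.cocycle hU = lerayCentralCocycle μ (isContinuousNontrivial_mulShift_half hψ) (isAlt_alt_polar_gram T)
      (nondegenerate_alt_polar_gram T hT) hY)
    (a : GL ι F) : r (transportSp T hT (levi a)) = leviOpPi (glEquiv a) := by
  -- the two implementers of `m(a)` differ by a scalar `c`
  obtain ⟨c, hc⟩ := hU _ (leviOpPi (glEquiv a)) (r (transportSp T hT (levi a)))
    (implements_transportSp_levi_leviOpPi T hT hl hbT a) (r.implements _)
  -- a test function with `Φ₀(0) = 1`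
  set Φ₀ : SchwartzBruhat (ι → F) :=
    ⟨(piPrimePowBall F ι 0).indicator fun _ => (1 : ℂ), indicator_piPrimePowBall_mem_schwartzBruhat 0 1⟩ with hΦ₀_def
  have hΦ₀ : (Φ₀ : (ι → F) → ℂ) 0 = 1 := by
    rw [hΦ₀_def]
    exact Set.indicator_of_mem (zero_mem_piPrimePowBall (F := F) (ι := ι) 0) (fun _ => (1 : ℂ))
  -- value at the origin: `c |det a|^{-1/2} = |det (m(a)|_{ℓ_Y})|^{1/2} = |det a⁻¹|^{1/2}`
  have hg := map_transportSp_levi_prod_bot_top T hT a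
  have h1 : Submodule.map ((((1 : symplecticGroup (polar (Matrix.toLinearMap₂' F T))) :
      symplecticGroup (polar (Matrix.toLinearMap₂' F T))) : ((ι → F) × (ι → F)) ≃ₗ[F] ((ι → F) × (ι → F))) :
        ((ι → F) × (ι → F)) →ₗ[F] ((ι → F) × (ι → F)))
      (Submodule.prod (⊥ : Submodule F (ι → F)) (⊤ : Submodule F (ι → F))) =
      Submodule.prod (⊥ : Submodule F (ι → F)) (⊤ : Submodule F (ι → F)) := by
    rw [OneMemClass.coe_one, LinearEquiv.coe_toLinearMap_one, Submodule.map_id]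
  have key := apply_zero_conj_eq_gram T hT hl hbT μ hψ hU r hY hr 1 h1 (transportSp T hT (levi a)) hg Φ₀
  rw [r.map_one, inv_one, mul_one, one_mul, hc Φ₀, Submodule.coe_smul, Pi.smul_apply, smul_eq_mul,
    coe_leviOpPi_apply, map_zero, hΦ₀, mul_one, mul_one, det_restrict_transportSp_levi T hT a hg] at key
  -- `|det a⁻¹|^{1/2} = (|det a|^{1/2})⁻¹`
  have hinv : Real.sqrt (normAbs F (((a⁻¹ : GL ι F) : Matrix ι ι F)).det) = (modSqrt (glEquiv a))⁻¹ := by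
    rw [← modSqrt_glEquiv, ← modSqrt_symm]
    congr 1
  have hne : ((modSqrt (glEquiv a) : ℂ))⁻¹ ≠ 0 :=
    inv_ne_zero (Complex.ofReal_ne_zero.2 (modSqrt_pos (glEquiv a)).ne')
  rw [hinv, Complex.ofReal_inv] at key
  have hc1 : (c : ℂ) = 1 := (mul_eq_right₀ hne).1 key
  refine LinearEquiv.ext fun f => ?_
  rw [hc f, hc1, one_smul]

end Gram

end Literature.RepresentationTheory.HeisenbergGroup

end
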